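import Literature.NumberTheory.Sieve.FriedlanderIwaniecPrimesEigenvalueLinearForms
import Literature.NumberTheory.Sieve.FriedlanderIwaniecPrimesVaughanEngine
import Literature.NumberTheory.Sieve.FriedlanderIwaniecPrimesKubotaBilinear
import HarnessLib

/-!
# Friedlander–Iwaniec, *The polynomial `X² + Y⁴` captures its primes*, §26: Theorem 2^ψ (power-saving form) from Propositions 23.1 and 23.2

Family `parity` (rung F-SPIN). Source: J. Friedlander, H. Iwaniec, Ann. of Math. (2) 148 (1998),
945–1040 [FriedlanderIwaniecAnnals1998] (= arXiv:math/9811185), §26 "Proof of Theorem 2^ψ"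
(arXiv pp. 84–86): "THEOREM 2^ψ. For any `c ≥ 1` we have (26.2) `Σ_{n≤x} Λ(n) λ(cn) ≪ c 𝔣 x^{76/77}`
where `𝔣 = d(|k|+1)` and the implied constant is absolute. … Next we apply a formula of Vaughan's
type … From the linear terms we get linear forms in `λ(ℓ)` and from the quadratic terms we get
bilinear forms in `λ(ℓ)`. The latter ones, `ℒ(M, N)`, have bounded coefficients and are of type which
we have treated in Proposition 23.1 … The linear forms … it is better to apply Proposition 23.2."

## What is here

* `FriedlanderIwaniec1998_prop231` — **Proposition 23.1 (23.8) as a named fact** (not yet proved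
  in the tree; its printed proof is Proposition 21.4 — bilinear forms `𝒦(M, N)` in Jacobi–Kubota
  symbols, from Proposition 21.3 [tree: `norm_dirichletBilin_disc_le`] — plus the reductions of §23):
  for every `ε > 0` a constant `C(ε)` with
  `‖Σ_{m ≤ M} Σ_{n ≤ N} α(m) β(n) λ(cmn)‖ ≤ C τ(c) (M+N)^{1/12} (MN)^{11/12+ε}` for all `d ≥ 1`, `χ`,
  `k`, `c ≥ 1`, `M, N ≥ 1`, `|α|, |β| ≤ 1`. This is the one remaining input of Theorem 2^ψ; it is
  literally the statement `Prop231` of the F-SPIN line skeleton.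
* PROVED: the three hypotheses of the tree's Vaughan engine (`PrimeSumEngine.TypeIBound`,
  `PrimeSumEngine.TypeIIBound`, `PrimeSumEngine.PointwiseBound`) for `n ↦ λ(cn)`: `pointwiseBound_quadEigenvalue`
  (`|λ(cn)| ≤ τ(c) τ(n)`), `typeIBound_quadEigenvalue` (from Proposition 23.2,
  `norm_sum_quadEigenvalue_mul_le`, with `τ(m) √m log ≪ m^{3/5} N^{1/20}`), `typeIIBound_quadEigenvalue`
  (from Proposition 23.1 at `ε = η = 10⁻⁴`); and the assembly
  `FriedlanderIwaniec1998_theorem2psi_powerSaving_of_prop231` — **Theorem 2^ψ with the power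
  saving `x^{1 - 1/1000}`** (`FriedlanderIwaniec1998_theorem2psiWith (1 - 1/1000)`, hence
  `FriedlanderIwaniec1998_theorem2psi_powerSaving`) from `FriedlanderIwaniec1998_prop231`, by the
  engine `PrimeSumEngine.exists_norm_sum_vonMangoldt_mul_le`.

The printed exponent `76/77` needs the engine's parameters re-tuned; any power saving serves
Proposition 17.2 and the power-saving Theorem 2 of the F-SPIN line.

## Update: Theorem 2^ψ unconditionally (appended)

`FriedlanderIwaniec1998_theorem2psi_powerSaving_holds` — **Theorem 2^ψ with the saving
`x^{1 - 1/1250}`, PROVED**: the type-II input is supplied not by the named fact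
`FriedlanderIwaniec1998_prop231` but by Proposition 21.4 [tree: `norm_kubotaBilin_le`,
`…KubotaBilinear`] applied to `ℒ(M, N)` written as a form `𝒦(cM, N)` (`bilinear_quadEigenvalue_eq`,
`norm_bilinear_quadEigenvalue_le`: constant `c^{1+ε}` in place of the printed `τ(c)`), plus the trivial
bound for `c > x²`. See the section "Theorem 2^ψ unconditionally" at the end of the file. The
explicit-exponent statement is `FriedlanderIwaniec1998_theorem2psiWith_holds :
FriedlanderIwaniec1998_theorem2psiWith (1 - 1/1250)` (used with this concrete `ϑ` by the §25
reduction of Proposition 17.2).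

## References

* J. Friedlander, H. Iwaniec, Ann. of Math. (2) 148 (1998), 945–1040, §23 Proposition 23.1 (23.8),
  Proposition 23.2 (23.11); §26 Theorem 2^ψ (26.1)–(26.3). [FriedlanderIwaniecAnnals1998]

## Tree / Mathlib

Tree: `FriedlanderIwaniecPrimes.quadEigenvalue`, `vonMangoldtEigenSum`,
`FriedlanderIwaniec1998_theorem2psiWith`, `…_theorem2psi_powerSaving` (`FriedlanderIwaniecSpin`),
`norm_sum_quadEigenvalue_mul_le` (`…EigenvalueLinearForms`), `PrimeSumEngine.TypeIBound`,
`PrimeSumEngine.TypeIIBound`, `PrimeSumEngine.PointwiseBound`, `PrimeSumEngine.eta`, `PrimeSumEngine.exists_norm_sum_vonMangoldt_mul_le` (`…VaughanEngine`),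
`Sieve.exists_card_divisors_le_mul_rpow`, `Vaughan.card_divisors_mul_le`,
`card_primaryNormEq_le_card_divisors`, `primaryNormEq_eq_empty_of_even`, `norm_kubotaBilin_le` (`…KubotaBilinear`),
`sum_quadEigenvalue_mul_eq`, `primaryNormLE` (`…EigenvalueLinearForms`, `…LinearForms`). Mathlib: `Real.log_le_rpow_div`,
`Real.rpow_*`, `Finset.sum_Icc_succ_top`, `Finset.sum_biUnion`.
-/

noncomputable section

open Finset
open scoped NumberTheorySymbols ArithmeticFunction.vonMangoldt

namespace Literature.NumberTheory.Sieve

open FriedlanderIwaniecPrimes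
open Literature.NumberTheory.QuadraticFields.GaussianPrimary

/-! ### Proposition 23.1 as a named fact -/

/-- **Friedlander–Iwaniec 1998, Proposition 23.1, (23.8)** (named fact; not yet proved in the tree):
"For any complex coefficients `α(m), β(n)` satisfying (23.5), (23.6) [`|α(m)|, |β(n)| ≤ 1` on
`1 ≤ m ≤ M`, `1 ≤ n ≤ N`] respectively, and for any `c ≥ 1` we have
`ℒ(M, N) = Σ_m Σ_n α(m)β(n)λ(cmn) ≪ τ(c)(M+N)^{1/12}(MN)^{11/12+ε}` where the implied constant
depends only on `ε`" — uniformly in the Hecke character `ψ = χ (z/|z|)^k` to modulus `4d`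
(`λ = quadEigenvalue d χ k`, (23.1)). [cite: FriedlanderIwaniecAnnals1998, Proposition 23.1 (23.8)] -/
def FriedlanderIwaniec1998_prop231 : Prop :=
  ∀ ε : ℝ, 0 < ε → ∃ C : ℝ, ∀ d : ℕ, 1 ≤ d →
    ∀ χ : MulChar (GaussQuot (4 * d)) ℂ, ∀ k : ℤ,
    ∀ c : ℕ, 1 ≤ c → ∀ M N : ℕ, 1 ≤ M → 1 ≤ N → ∀ α β : ℕ → ℂ,
      (∀ m, ‖α m‖ ≤ 1) → (∀ n, ‖β n‖ ≤ 1) →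
      ‖∑ m ∈ Icc 1 M, ∑ n ∈ Icc 1 N, α m * β n * quadEigenvalue d χ k (c * m * n)‖ ≤
        C * (c.divisors.card : ℝ) * ((M : ℝ) + N) ^ (1 / 12 : ℝ) * ((M : ℝ) * N) ^ (11 / 12 + ε : ℝ)

namespace FriedlanderIwaniecPrimes

/-! ### The pointwise bound `|λ(n)| ≤ τ(n)` -/

/-- `|λ(n)| ≤ #{z primary : z z̄ = n} ≤ τ(n)`. [cite: FriedlanderIwaniecAnnals1998, (23.1)] -/
theorem norm_quadEigenvalue_le (d : ℕ) (hd : 1 ≤ d) (χ : MulChar (GaussQuot (4 * d)) ℂ) (k : ℤ)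
    (n : ℕ) : ‖quadEigenvalue d χ k n‖ ≤ n.divisors.card := by
  haveI : NeZero d := ⟨by omega⟩
  rw [quadEigenvalue]
  rcases Nat.eq_zero_or_pos n with rfl | hn
  · rw [primaryNormEq_eq_empty_of_even (dvd_zero 2), sum_empty, norm_zero]; positivity
  calc ‖∑ z ∈ primaryNormEq n, heckePsi d χ k z * jacobiKubota z‖
      ≤ ∑ z ∈ primaryNormEq n, ‖heckePsi d χ k z * jacobiKubota z‖ := norm_sum_le _ _
    _ ≤ ∑ z ∈ primaryNormEq n, (1 : ℝ) := by
        refine sum_le_sum fun z _ => ?_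
        rw [norm_mul]
        calc ‖heckePsi d χ k z‖ * ‖jacobiKubota z‖ ≤ 1 * 1 :=
              mul_le_mul (norm_heckePsi_le_one d χ k z) (norm_jacobiKubota_le_one z) (norm_nonneg _)
                zero_le_one
          _ = 1 := one_mul _
    _ = (primaryNormEq n).card := by simp
    _ ≤ n.divisors.card := by exact_mod_cast card_primaryNormEq_le_card_divisors n hn.ne'

/-- **Pointwise hypothesis of the engine** for `n ↦ λ(cn)`: `|λ(cn)| ≤ τ(c) τ(n)`.
[cite: FriedlanderIwaniecAnnals1998, §26] -/
theorem pointwiseBound_quadEigenvalue (d : ℕ) (hd : 1 ≤ d) (χ : MulChar (GaussQuot (4 * d)) ℂ)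
    (k : ℤ) (c : ℕ) : PrimeSumEngine.PointwiseBound (fun n => quadEigenvalue d χ k (c * n)) (c.divisors.card) := by
  intro n
  calc ‖quadEigenvalue d χ k (c * n)‖ ≤ (c * n).divisors.card := norm_quadEigenvalue_le d hd χ k _
    _ ≤ (c.divisors.card : ℝ) * n.divisors.card := by
        exact_mod_cast Literature.NumberTheory.Sieve.Vaughan.card_divisors_mul_le c n

/-! ### The type-I hypothesis from Proposition 23.2 -/

/-- `Icc 1 N = Ioc 0 N` in `ℕ`. [folklore] -/
private theorem Icc_one_eq_Ioc_zero (N : ℕ) : Icc 1 N = Ioc 0 N := by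
  ext n; simp only [mem_Icc, mem_Ioc]; omega

/-- **Type-I hypothesis of the engine** for `n ↦ λ(cn)`, from Proposition 23.2: there is an absolute
`C₁` with `‖Σ_{n ≤ N} λ(c d' n)‖ ≤ C₁ · c d(|k|+1) · d' N^{4/5}` for all `d', N ≥ 1` (the source:
"τ(d)⁴ d^{1/2} log ≪ d", "N^{3/4} log N ≪ N^{4/5}"). [cite: FriedlanderIwaniecAnnals1998, §26] -/
theorem typeIBound_quadEigenvalue :
    ∃ C₁ : ℝ, 1 ≤ C₁ ∧ ∀ d : ℕ, 1 ≤ d → ∀ χ : MulChar (GaussQuot (4 * d)) ℂ, ∀ k : ℤ,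
      ∀ c : ℕ, 1 ≤ c →
        PrimeSumEngine.TypeIBound (fun n => quadEigenvalue d χ k (c * n)) (C₁ * c * (d * (|k| + 1 : ℝ))) := by
  obtain ⟨C, hC, hP⟩ := norm_sum_quadEigenvalue_mul_le
  obtain ⟨Cτ, hCτ1, hCτ⟩ := Literature.NumberTheory.Sieve.exists_card_divisors_le_mul_rpow
    (ε := 1 / 20) (by norm_num)
  refine ⟨20 * C * Cτ + Cτ, ?_, ?_⟩
  · have : 0 ≤ 20 * C * Cτ := by positivity
    linarith
  intro d hd χ k c hc d' N hd' hN
  have hCτ0 : 0 < Cτ := by linarith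
  have hf1 : (1 : ℝ) ≤ (d * (|k| + 1 : ℝ)) := by
    have h1 : (1 : ℝ) ≤ d := by exact_mod_cast hd
    have h2 : (1 : ℝ) ≤ |(k : ℝ)| + 1 := by have := abs_nonneg (k : ℝ); linarith
    push_cast; nlinarith
  set m : ℕ := c * d' with hm
  have hm1 : 1 ≤ m := Nat.mul_pos hc hd'
  have hm1' : (1 : ℝ) ≤ m := by exact_mod_cast hm1
  have hsum : ∑ n ∈ Ioc 0 N, quadEigenvalue d χ k (c * (d' * n)) =
      ∑ n ∈ Icc 1 N, quadEigenvalue d χ k (m * n) := by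
    rw [Icc_one_eq_Ioc_zero]
    refine sum_congr rfl fun n _ => ?_
    rw [hm, mul_assoc]
  rw [hsum]
  have hN1 : (1 : ℝ) ≤ N := by exact_mod_cast hN
  rcases Nat.lt_or_ge N 2 with hN2 | hN2
  · -- `N = 1`: a single term
    have hN1' : N = 1 := by omega
    subst hN1'
    rw [show Icc 1 1 = {1} by rfl, sum_singleton, mul_one, Nat.cast_one, Real.one_rpow, mul_one]
    calc ‖quadEigenvalue d χ k m‖ ≤ m.divisors.card := norm_quadEigenvalue_le d hd χ k m
      _ ≤ Cτ * (m : ℝ) ^ (1 / 20 : ℝ) := hCτ m (by omega)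
      _ ≤ Cτ * m := by
          refine mul_le_mul_of_nonneg_left ?_ hCτ0.le
          calc (m : ℝ) ^ (1 / 20 : ℝ) ≤ (m : ℝ) ^ (1 : ℝ) :=
                Real.rpow_le_rpow_of_exponent_le hm1' (by norm_num)
            _ = m := Real.rpow_one _
      _ = Cτ * c * 1 * d' := by rw [hm]; push_cast; ring
      _ ≤ (20 * C * Cτ + Cτ) * c * (d * (|k| + 1 : ℝ)) * d' := by
          have h1 : Cτ * (c : ℝ) ≤ (20 * C * Cτ + Cτ) * c := by
            refine mul_le_mul_of_nonneg_right ?_ (by positivity)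
            have : 0 ≤ 20 * C * Cτ := by positivity
            linarith
          refine mul_le_mul_of_nonneg_right (mul_le_mul h1 hf1 zero_le_one (by positivity)) (by positivity)
  · -- `N ≥ 2`: Proposition 23.2
    have h := hP d hd χ k m hm1 N hN2
    refine h.trans ?_
    -- `τ(m) ≤ Cτ m^{1/20}`, `log(mN) ≤ 20 (mN)^{1/20}`
    have hτ : (m.divisors.card : ℝ) ≤ Cτ * (m : ℝ) ^ (1 / 20 : ℝ) := hCτ m (by omega)
    have hmN0 : (0 : ℝ) ≤ (m : ℝ) * N := by positivity
    have hlog : Real.log ((m : ℝ) * N) ≤ 20 * ((m : ℝ) ^ (1 / 20 : ℝ) * (N : ℝ) ^ (1 / 20 : ℝ)) := by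
      have := Real.log_le_rpow_div hmN0 (by norm_num : (0 : ℝ) < 1 / 20)
      rw [Real.mul_rpow (by positivity) (by positivity)] at this
      linarith
    have hlog0 : 0 ≤ Real.log ((m : ℝ) * N) := Real.log_nonneg (by nlinarith)
    have hm0 : (0 : ℝ) < m := by linarith
    have hN0 : (0 : ℝ) < N := by linarith
    -- collect powers: `m^{1/20} √m m^{1/20} = m^{3/5} ≤ m`, `N^{3/4} N^{1/20} = N^{4/5}`
    have hsqrt : Real.sqrt (m : ℝ) = (m : ℝ) ^ (1 / 2 : ℝ) := Real.sqrt_eq_rpow _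
    have hmpow : (m : ℝ) ^ (1 / 20 : ℝ) * (m : ℝ) ^ (1 / 2 : ℝ) * (m : ℝ) ^ (1 / 20 : ℝ) ≤ m := by
      rw [← Real.rpow_add hm0, ← Real.rpow_add hm0]
      calc (m : ℝ) ^ (1 / 20 + 1 / 2 + 1 / 20 : ℝ) ≤ (m : ℝ) ^ (1 : ℝ) :=
            Real.rpow_le_rpow_of_exponent_le hm1' (by norm_num)
        _ = m := Real.rpow_one _
    have hNpow : (N : ℝ) ^ (3 / 4 : ℝ) * (N : ℝ) ^ (1 / 20 : ℝ) = (N : ℝ) ^ (4 / 5 : ℝ) := by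
      rw [← Real.rpow_add hN0]; norm_num
    calc C * (d * (|k| + 1 : ℝ)) * (m.divisors.card : ℝ) * Real.sqrt m * (N : ℝ) ^ (3 / 4 : ℝ) *
          Real.log ((m : ℝ) * N)
        ≤ C * (d * (|k| + 1 : ℝ)) * (Cτ * (m : ℝ) ^ (1 / 20 : ℝ)) * Real.sqrt m * (N : ℝ) ^ (3 / 4 : ℝ) *
          (20 * ((m : ℝ) ^ (1 / 20 : ℝ) * (N : ℝ) ^ (1 / 20 : ℝ))) := by
          have h0 : 0 ≤ C * (d * (|k| + 1 : ℝ)) := by positivity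
          refine mul_le_mul ?_ hlog hlog0 (by positivity)
          refine mul_le_mul_of_nonneg_right (mul_le_mul_of_nonneg_right ?_ (Real.sqrt_nonneg _)) (by positivity)
          exact mul_le_mul_of_nonneg_left hτ h0
      _ = 20 * C * Cτ * (d * (|k| + 1 : ℝ)) *
          ((m : ℝ) ^ (1 / 20 : ℝ) * (m : ℝ) ^ (1 / 2 : ℝ) * (m : ℝ) ^ (1 / 20 : ℝ)) *
          ((N : ℝ) ^ (3 / 4 : ℝ) * (N : ℝ) ^ (1 / 20 : ℝ)) := by rw [hsqrt]; ring
      _ ≤ 20 * C * Cτ * (d * (|k| + 1 : ℝ)) * m * ((N : ℝ) ^ (3 / 4 : ℝ) * (N : ℝ) ^ (1 / 20 : ℝ)) := by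
          refine mul_le_mul_of_nonneg_right (mul_le_mul_of_nonneg_left hmpow (by positivity)) (by positivity)
      _ = 20 * C * Cτ * c * (d * (|k| + 1 : ℝ)) * d' * (N : ℝ) ^ (4 / 5 : ℝ) := by
          rw [hNpow, hm]; push_cast; ring
      _ ≤ (20 * C * Cτ + Cτ) * c * (d * (|k| + 1 : ℝ)) * d' * (N : ℝ) ^ (4 / 5 : ℝ) := by
          have : 20 * C * Cτ ≤ 20 * C * Cτ + Cτ := by linarith
          gcongr

/-! ### The type-II hypothesis from Proposition 23.1 -/

/-- **Type-II hypothesis of the engine** for `n ↦ λ(cn)`, from Proposition 23.1 at `ε = η`.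
[cite: FriedlanderIwaniecAnnals1998, §26] -/
theorem typeIIBound_quadEigenvalue (h231 : FriedlanderIwaniec1998_prop231) :
    ∃ C₂ : ℝ, 0 ≤ C₂ ∧ ∀ d : ℕ, 1 ≤ d → ∀ χ : MulChar (GaussQuot (4 * d)) ℂ, ∀ k : ℤ,
      ∀ c : ℕ, 1 ≤ c → PrimeSumEngine.TypeIIBound (fun n => quadEigenvalue d χ k (c * n)) (C₂ * c.divisors.card) := by
  obtain ⟨C, hC⟩ := h231 PrimeSumEngine.eta (by rw [PrimeSumEngine.eta]; norm_num)
  refine ⟨max C 0, le_max_right _ _, fun d hd χ k c hc M N hM hN α β hα hβ => ?_⟩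
  have h := hC d hd χ k c hc M N hM hN α β hα hβ
  have hsum : ∑ m ∈ Ioc 0 M, ∑ n ∈ Ioc 0 N, α m * β n * quadEigenvalue d χ k (c * (m * n)) =
      ∑ m ∈ Icc 1 M, ∑ n ∈ Icc 1 N, α m * β n * quadEigenvalue d χ k (c * m * n) := by
    rw [Icc_one_eq_Ioc_zero, Icc_one_eq_Ioc_zero]
    refine sum_congr rfl fun m _ => sum_congr rfl fun n _ => ?_
    simp only [mul_assoc]
  rw [hsum]
  refine h.trans ?_
  have h0 : 0 ≤ (c.divisors.card : ℝ) * ((M : ℝ) + N) ^ (1 / 12 : ℝ) * ((M : ℝ) * N) ^ (11 / 12 + PrimeSumEngine.eta) := by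
    positivity
  calc C * (c.divisors.card : ℝ) * ((M : ℝ) + N) ^ (1 / 12 : ℝ) * ((M : ℝ) * N) ^ (11 / 12 + PrimeSumEngine.eta)
      = C * ((c.divisors.card : ℝ) * ((M : ℝ) + N) ^ (1 / 12 : ℝ) * ((M : ℝ) * N) ^ (11 / 12 + PrimeSumEngine.eta)) := by ring
    _ ≤ max C 0 * ((c.divisors.card : ℝ) * ((M : ℝ) + N) ^ (1 / 12 : ℝ) * ((M : ℝ) * N) ^ (11 / 12 + PrimeSumEngine.eta)) :=
        mul_le_mul_of_nonneg_right (le_max_left _ _) h0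
    _ = _ := by ring

/-! ### Theorem 2^ψ with a power saving -/

/-- Monotonicity of the engine hypotheses in the constant. [folklore] -/
private theorem typeIBound_mono {lam : ℕ → ℂ} {W W' : ℝ} (h : PrimeSumEngine.TypeIBound lam W) (hW : W ≤ W') :
    PrimeSumEngine.TypeIBound lam W' := fun d N hd hN =>
  (h d N hd hN).trans (mul_le_mul_of_nonneg_right (mul_le_mul_of_nonneg_right hW (by positivity))
    (by positivity))

/-- Monotonicity of the type-II hypothesis in the constant. [folklore] -/
private theorem typeIIBound_mono {lam : ℕ → ℂ} {W W' : ℝ} (h : PrimeSumEngine.TypeIIBound lam W) (hW : W ≤ W') :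
    PrimeSumEngine.TypeIIBound lam W' := fun M N hM hN α β hα hβ =>
  (h M N hM hN α β hα hβ).trans (mul_le_mul_of_nonneg_right
    (mul_le_mul_of_nonneg_right hW (by positivity)) (by positivity))

end FriedlanderIwaniecPrimes

/-- **Friedlander–Iwaniec, Theorem 2^ψ (26.2), power-saving form, from Proposition 23.1.** Given
Proposition 23.1 (`FriedlanderIwaniec1998_prop231`), there is an absolute `C` with
`‖Σ_{n ≤ x} Λ(n) λ(cn)‖ ≤ C · c · d(|k|+1) · x^{1 - 1/1000}` for all `d, c ≥ 1`, `χ`, `k`, `x ≥ 2`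
(`FriedlanderIwaniec1998_theorem2psiWith (1 - 1/1000)`), hence
`FriedlanderIwaniec1998_theorem2psi_powerSaving`; by the tree's Vaughan engine
(`PrimeSumEngine.exists_norm_sum_vonMangoldt_mul_le`) fed with Proposition 23.2 (proved, type I) and Proposition
23.1 (type II). [cite: FriedlanderIwaniecAnnals1998, Theorem 2^ψ (26.2)] -/
theorem FriedlanderIwaniec1998_theorem2psi_powerSaving_of_prop231 (h231 : FriedlanderIwaniec1998_prop231) :
    FriedlanderIwaniec1998_theorem2psi_powerSaving := by
  obtain ⟨CE, hCE, hE⟩ := PrimeSumEngine.exists_norm_sum_vonMangoldt_mul_le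
  obtain ⟨C₁, hC₁, hI⟩ := typeIBound_quadEigenvalue
  obtain ⟨C₂, hC₂, hII⟩ := typeIIBound_quadEigenvalue h231
  refine ⟨1 - 1 / 1000, by norm_num, CE * (C₁ + C₂ + 1), ?_⟩
  intro d hd χ k c hc x hx
  set lam : ℕ → ℂ := fun n => quadEigenvalue d χ k (c * n) with hlam
  set f : ℝ := (d * (|k| + 1 : ℝ)) with hf
  have hf1 : (1 : ℝ) ≤ f := by
    have h1 : (1 : ℝ) ≤ d := by exact_mod_cast hd
    have h2 : (1 : ℝ) ≤ |(k : ℝ)| + 1 := by have := abs_nonneg (k : ℝ); linarith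
    rw [hf]; push_cast; nlinarith
  have hc1 : (1 : ℝ) ≤ c := by exact_mod_cast hc
  have hτc : (c.divisors.card : ℝ) ≤ c := by exact_mod_cast Nat.card_divisors_le_self c
  -- the common constant `W`
  set W : ℝ := C₁ * c * f + C₂ * c.divisors.card with hW
  have hW0 : 0 ≤ W := by positivity
  have hIW : PrimeSumEngine.TypeIBound lam W :=
    typeIBound_mono (hI d hd χ k c hc) (by rw [hW, hf]; linarith [mul_nonneg hC₂ (Nat.cast_nonneg (c.divisors.card))])
  have hIIW : PrimeSumEngine.TypeIIBound lam W :=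
    typeIIBound_mono (hII d hd χ k c hc) (by
      rw [hW]; have : 0 ≤ C₁ * c * f := by positivity
      linarith)
  have hB := pointwiseBound_quadEigenvalue d hd χ k c
  set X : ℕ := ⌊x⌋₊ with hX
  have hX2 : 2 ≤ X := by rw [hX]; exact Nat.le_floor (by exact_mod_cast hx)
  have hengine := hE lam W c.divisors.card hW0 (by positivity) hIW hIIW hB X (by omega)
  -- identify the sum
  have hsum : vonMangoldtEigenSum d χ k c x = ∑ n ∈ Ioc 0 X, ((Λ n : ℝ) : ℂ) * lam n := by
    rw [vonMangoldtEigenSum, FriedlanderIwaniecPrimes.Icc_one_eq_Ioc_zero]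
  rw [hsum]
  refine hengine.trans ?_
  -- `W + τ(c) ≤ (C₁ + C₂ + 1) c f` and `X ≤ x`
  have hWB : W + c.divisors.card ≤ (C₁ + C₂ + 1) * c * f := by
    rw [hW]
    have h1 : C₂ * (c.divisors.card : ℝ) ≤ C₂ * c * f := by
      calc C₂ * (c.divisors.card : ℝ) ≤ C₂ * c := mul_le_mul_of_nonneg_left hτc hC₂
        _ = C₂ * c * 1 := (mul_one _).symm
        _ ≤ C₂ * c * f := mul_le_mul_of_nonneg_left hf1 (by positivity)
    have h2 : (c.divisors.card : ℝ) ≤ 1 * c * f := by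
      calc (c.divisors.card : ℝ) ≤ c := hτc
        _ = 1 * c * 1 := by ring
        _ ≤ 1 * c * f := mul_le_mul_of_nonneg_left hf1 (by positivity)
    linarith
  have hx0 : (0 : ℝ) < x := by linarith
  have hXx : (X : ℝ) ≤ x := Nat.floor_le hx0.le
  have hXpow : (X : ℝ) ^ (1 - 1 / 1000 : ℝ) ≤ x ^ (1 - 1 / 1000 : ℝ) :=
    Real.rpow_le_rpow (by positivity) hXx (by norm_num)
  calc CE * (W + c.divisors.card) * (X : ℝ) ^ (1 - 1 / 1000 : ℝ)
      ≤ CE * ((C₁ + C₂ + 1) * c * f) * x ^ (1 - 1 / 1000 : ℝ) := by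
        refine mul_le_mul (mul_le_mul_of_nonneg_left hWB hCE.le) hXpow (by positivity) (by positivity)
    _ = CE * (C₁ + C₂ + 1) * c * (d * (|k| + 1 : ℝ)) * x ^ (1 - 1 / 1000 : ℝ) := by rw [hf]; ring

/-! ## Theorem 2^ψ unconditionally: the type-II bound from Proposition 21.4

Source, §23 and §26: the bilinear forms `ℒ(M, N) = Σ_m Σ_n α(m) β(n) λ(cmn)` ((23.4)) are "of type
which we have treated in Proposition 23.1". Here `ℒ(M, N)` is bounded DIRECTLY by Proposition 21.4
[tree: `norm_kubotaBilin_le`]: by the unique factorisation of a primitive primary `ζ` along a divisor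
of its norm (`sum_quadEigenvalue_mul_eq`), `λ(qn) = Σ_{ww̄ = q} Σ_{zz̄ = n} ψ(w) ψ(z) [wz]`
(`quadEigenvalue_mul_eq_sum`), so that `ℒ(M, N)` is itself a form `𝒦(cM, N)` in `[wz]` with
coefficients `α(ww̄/c) ψ(w)` supported on `c ∣ ww̄ ≤ cM` and `β(zz̄) ψ(z)`
(`bilinear_quadEigenvalue_eq`). Proposition 21.4 then gives
`ℒ(M, N) ≪ (cM + N)^{1/12} (cMN)^{11/12+ε} ≤ c^{1+ε} (M+N)^{1/12} (MN)^{11/12+ε}`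
(`norm_bilinear_quadEigenvalue_le`; the printed (23.8) has `τ(c)` in place of `c^{1+ε}`, which the
application does not need). Feeding this (type II), Proposition 23.2 (type I) and `|λ(cn)| ≤ τ(c)τ(n)`
to the Vaughan engine gives `Σ_{n ≤ x} Λ(n) λ(cn) ≪ c^{1+η} 𝔣 x^{1-1/1000}` for `c ≤ x²`, while for
`c > x²` the trivial bound `≪ c^{1/4} x^{3/2} ≤ c` is better; together:
**Theorem 2^ψ with the saving `x^{1 - 1/1250}`**, `FriedlanderIwaniec1998_theorem2psi_powerSaving_holds`. -/

namespace FriedlanderIwaniecPrimes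

/-! ### `λ(qn)` as a double sum over primary `w`, `z` with `ww̄ = q`, `zz̄ = n` -/

/-- The sets `{z primary : zz̄ = i}` are pairwise disjoint. [folklore] -/
private theorem pairwiseDisjoint_primaryNormEq' (s : Set ℕ) : s.PairwiseDisjoint primaryNormEq := by
  intro i _ j _ hij
  rw [Function.onFun, Finset.disjoint_left]
  intro z hi hj
  rw [mem_primaryNormEq] at hi hj
  exact hij (by exact_mod_cast hi.1.symm.trans hj.1)

/-- `Σ_{1 ≤ zz̄ ≤ m+1} g(z) = Σ_{1 ≤ zz̄ ≤ m} g(z) + Σ_{zz̄ = m+1} g(z)`. [folklore] -/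
private theorem sum_primaryNormLE_succ (m : ℕ) (g : GaussianInt → ℂ) :
    ∑ z ∈ primaryNormLE (m + 1), g z = ∑ z ∈ primaryNormLE m, g z + ∑ z ∈ primaryNormEq (m + 1), g z := by
  rw [primaryNormLE, primaryNormLE, sum_biUnion (pairwiseDisjoint_primaryNormEq' _),
    sum_biUnion (pairwiseDisjoint_primaryNormEq' _), Finset.sum_Icc_succ_top (by omega)]

/-- **`λ(qn) = Σ_{w primary, ww̄ = q} ψ(w) Σ_{z primary, zz̄ = n} ψ(z) [wz]`** for `q, n ≥ 1` (the
term `n` of the factorisation `sum_quadEigenvalue_mul_eq` of `Σ_{n ≤ N} λ(qn)`).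
[cite: FriedlanderIwaniecAnnals1998, (23.9)–(23.12)] -/
theorem quadEigenvalue_mul_eq_sum (d : ℕ) (χ : MulChar (GaussQuot (4 * d)) ℂ) (k : ℤ) {q n : ℕ}
    (hq : 1 ≤ q) (hn : 1 ≤ n) :
    quadEigenvalue d χ k (q * n) = ∑ w ∈ primaryNormEq q, heckePsi d χ k w *
      ∑ z ∈ primaryNormEq n, heckePsi d χ k z * jacobiKubota (w * z) := by
  obtain ⟨m, rfl⟩ : ∃ m, n = m + 1 := ⟨n - 1, by omega⟩
  have h1 := sum_quadEigenvalue_mul_eq d χ k hq (m + 1)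
  rw [Finset.sum_Icc_succ_top (by omega), sum_quadEigenvalue_mul_eq d χ k hq m] at h1
  set L := quadEigenvalue d χ k (q * (m + 1)) with hL
  simp_rw [sum_primaryNormLE_succ m, mul_add, sum_add_distrib] at h1
  exact add_left_cancel h1

/-! ### `ℒ(M, N)` as a bilinear form `𝒦(cM, N)` in Jacobi–Kubota symbols -/

/-- The sets `{w primary : ww̄ = cm}`, `m` varying, are pairwise disjoint (`c ≥ 1`). [folklore] -/
private theorem pairwiseDisjoint_primaryNormEq_mul {c : ℕ} (hc : 1 ≤ c) (s : Set ℕ) :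
    s.PairwiseDisjoint fun m => primaryNormEq (c * m) := by
  intro i _ j _ hij
  rw [Function.onFun, Finset.disjoint_left]
  intro z hi hj
  rw [mem_primaryNormEq] at hi hj
  have : (c : ℤ) * i = c * j := by have h := hi.1.symm.trans hj.1; push_cast at h; exact h
  exact hij (by exact_mod_cast mul_left_cancel₀ (by exact_mod_cast (by omega : c ≠ 0) : (c : ℤ) ≠ 0) this)

/-- **`ℒ(M, N)` is a form `𝒦(cM, N)`**:
`Σ_{m ≤ M} Σ_{n ≤ N} α(m) β(n) λ(cmn) = Σ_{1 ≤ ww̄ ≤ cM} Σ_{1 ≤ zz̄ ≤ N} α'(w) β'(z) [wz]` with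
`α'(w) = α(ww̄/c) ψ(w)` for `c ∣ ww̄` (else `0`) and `β'(z) = β(zz̄) ψ(z)`, all `w, z` primary.
[cite: FriedlanderIwaniecAnnals1998, (23.4), (23.9)–(23.10)] -/
theorem bilinear_quadEigenvalue_eq (d : ℕ) (χ : MulChar (GaussQuot (4 * d)) ℂ) (k : ℤ) {c : ℕ}
    (hc : 1 ≤ c) (M N : ℕ) (α β : ℕ → ℂ) :
    ∑ m ∈ Icc 1 M, ∑ n ∈ Icc 1 N, α m * β n * quadEigenvalue d χ k (c * m * n) =
      ∑ w ∈ primaryNormLE (c * M), ∑ z ∈ primaryNormLE N,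
        ((if (c : ℤ) ∣ w.norm then α (w.norm.toNat / c) else 0) * heckePsi d χ k w) *
          (β z.norm.toNat * heckePsi d χ k z) * jacobiKubota (w * z) := by
  have hc0 : (c : ℤ) ≠ 0 := by exact_mod_cast (by omega : c ≠ 0)
  -- expand `λ(cmn)` and reorder
  have step1 : ∀ m ∈ Icc 1 M,
      ∑ n ∈ Icc 1 N, α m * β n * quadEigenvalue d χ k (c * m * n) =
        ∑ w ∈ primaryNormEq (c * m), ∑ z ∈ primaryNormLE N,
          (α m * heckePsi d χ k w) * (β z.norm.toNat * heckePsi d χ k z) * jacobiKubota (w * z) := by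
    intro m hm
    have hm1 : 1 ≤ m := (mem_Icc.mp hm).1
    calc ∑ n ∈ Icc 1 N, α m * β n * quadEigenvalue d χ k (c * m * n)
        = ∑ n ∈ Icc 1 N, ∑ w ∈ primaryNormEq (c * m), ∑ z ∈ primaryNormEq n,
            (α m * heckePsi d χ k w) * (β z.norm.toNat * heckePsi d χ k z) * jacobiKubota (w * z) := by
          refine sum_congr rfl fun n hn => ?_
          have hn1 : 1 ≤ n := (mem_Icc.mp hn).1
          rw [quadEigenvalue_mul_eq_sum d χ k (Nat.mul_pos hc hm1) hn1]
          simp only [mul_sum]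
          refine sum_congr rfl fun w _ => sum_congr rfl fun z hz => ?_
          rw [(mem_primaryNormEq.mp hz).1, Int.toNat_natCast]
          ring
      _ = ∑ w ∈ primaryNormEq (c * m), ∑ n ∈ Icc 1 N, ∑ z ∈ primaryNormEq n,
            (α m * heckePsi d χ k w) * (β z.norm.toNat * heckePsi d χ k z) * jacobiKubota (w * z) :=
          sum_comm
      _ = _ := by
          refine sum_congr rfl fun w _ => ?_
          rw [primaryNormLE, sum_biUnion (pairwiseDisjoint_primaryNormEq' _)]
  rw [sum_congr rfl step1]
  -- the coefficient `α'` on `{ww̄ = cm}`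
  have step2 : ∀ m ∈ Icc 1 M, ∀ w ∈ primaryNormEq (c * m),
      ∑ z ∈ primaryNormLE N, (α m * heckePsi d χ k w) * (β z.norm.toNat * heckePsi d χ k z) * jacobiKubota (w * z) =
        ∑ z ∈ primaryNormLE N, ((if (c : ℤ) ∣ w.norm then α (w.norm.toNat / c) else 0) * heckePsi d χ k w) *
          (β z.norm.toNat * heckePsi d χ k z) * jacobiKubota (w * z) := by
    intro m _ w hw
    have hnorm := (mem_primaryNormEq.mp hw).1
    have hdvd : (c : ℤ) ∣ w.norm := ⟨m, by rw [hnorm]; push_cast; ring⟩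
    have hdiv : w.norm.toNat / c = m := by
      rw [hnorm, Int.toNat_natCast, Nat.mul_div_cancel_left m hc]
    simp_rw [if_pos hdvd, hdiv]
  rw [sum_congr rfl fun m hm => sum_congr rfl (step2 m hm), ← sum_biUnion (pairwiseDisjoint_primaryNormEq_mul hc _)]
  -- extend the `w`-range from `⋃_m {ww̄ = cm}` to `1 ≤ ww̄ ≤ cM` (the coefficient vanishes elsewhere)
  refine sum_subset ?_ ?_
  · intro w hw
    rw [mem_biUnion] at hw
    obtain ⟨m, hm, hw⟩ := hw
    rw [mem_Icc] at hm
    rw [mem_primaryNormEq] at hw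
    rw [mem_primaryNormLE, hw.1]
    refine ⟨hw.2, ?_, ?_⟩
    · have := Nat.mul_pos hc hm.1; exact_mod_cast this
    · exact_mod_cast Nat.mul_le_mul_left c hm.2
  · intro w hw hw'
    have hndvd : ¬ (c : ℤ) ∣ w.norm := by
      rintro ⟨t, ht⟩
      apply hw'
      rw [mem_primaryNormLE] at hw
      obtain ⟨hwp, h1, h2⟩ := hw
      have ht0 : 0 < t := by
        by_contra h
        push Not at h
        have : (c : ℤ) * t ≤ 0 := mul_nonpos_of_nonneg_of_nonpos (by positivity) h
        linarith
      have htM : t ≤ M := by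
        by_contra h
        push Not at h
        have : (c : ℤ) * (M + 1) ≤ c * t := mul_le_mul_of_nonneg_left (by omega) (by positivity)
        push_cast at h2
        nlinarith
      rw [mem_biUnion]
      refine ⟨t.toNat, mem_Icc.mpr ⟨by omega, by omega⟩, mem_primaryNormEq.mpr ⟨?_, hwp⟩⟩
      rw [ht]; push_cast; rw [Int.toNat_of_nonneg ht0.le]
    refine sum_eq_zero fun z _ => ?_
    rw [if_neg hndvd]; ring

/-- **The type-II bound for `λ`** (the role of Proposition 23.1 (23.8), here with `c^{1+ε}` for
`τ(c)`): for every `ε > 0` there is `C = C(ε)` with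
`|Σ_{m ≤ M} Σ_{n ≤ N} α(m) β(n) λ(cmn)| ≤ C c^{1+ε} (M+N)^{1/12} (MN)^{11/12+ε}` for all `d ≥ 1`, `χ`,
`k`, `c ≥ 1`, `M, N ≥ 1`, `|α|, |β| ≤ 1` — from Proposition 21.4 applied to `𝒦(cM, N)`.
[cite: FriedlanderIwaniecAnnals1998, Proposition 23.1 (proof), Proposition 21.4] -/
theorem norm_bilinear_quadEigenvalue_le {ε : ℝ} (hε : 0 < ε) :
    ∃ C : ℝ, 0 < C ∧ ∀ d : ℕ, 1 ≤ d → ∀ χ : MulChar (GaussQuot (4 * d)) ℂ, ∀ k : ℤ,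
      ∀ c : ℕ, 1 ≤ c → ∀ M N : ℕ, 1 ≤ M → 1 ≤ N → ∀ α β : ℕ → ℂ,
        (∀ m, ‖α m‖ ≤ 1) → (∀ n, ‖β n‖ ≤ 1) →
          ‖∑ m ∈ Icc 1 M, ∑ n ∈ Icc 1 N, α m * β n * quadEigenvalue d χ k (c * m * n)‖ ≤
            C * (c : ℝ) ^ (1 + ε) * ((M : ℝ) + N) ^ (1 / 12 : ℝ) * ((M : ℝ) * N) ^ (11 / 12 + ε) := by
  obtain ⟨C, hC, h⟩ := norm_kubotaBilin_le hε
  refine ⟨C, hC, fun d hd χ k c hc M N hM hN α β hα hβ => ?_⟩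
  haveI : NeZero d := ⟨by omega⟩
  rw [bilinear_quadEigenvalue_eq d χ k hc M N α β]
  have hcM : 1 ≤ c * M := Nat.mul_pos hc hM
  have hb := h (c * M) N hcM hN
    (fun w => (if (c : ℤ) ∣ w.norm then α (w.norm.toNat / c) else 0) * heckePsi d χ k w)
    (fun z => β z.norm.toNat * heckePsi d χ k z)
    (fun w => by
      rw [norm_mul]
      refine mul_le_one₀ ?_ (norm_nonneg _) (norm_heckePsi_le_one d χ k w)
      split_ifs
      · exact hα _
      · simp)
    (fun z => by
      rw [norm_mul]; exact mul_le_one₀ (hβ _) (norm_nonneg _) (norm_heckePsi_le_one d χ k z))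
  refine hb.trans ?_
  push_cast
  have hc0 : (0 : ℝ) < c := by exact_mod_cast hc
  have hM0 : (0 : ℝ) < M := by exact_mod_cast hM
  have hN0 : (0 : ℝ) < N := by exact_mod_cast hN
  have h1 : ((c : ℝ) * M + N) ^ (1 / 12 : ℝ) ≤ (c : ℝ) ^ (1 / 12 : ℝ) * ((M : ℝ) + N) ^ (1 / 12 : ℝ) := by
    rw [← Real.mul_rpow hc0.le (by positivity)]
    refine Real.rpow_le_rpow (by positivity) ?_ (by norm_num)
    have hc1 : (1 : ℝ) ≤ c := by exact_mod_cast hc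
    nlinarith
  have h2 : ((c : ℝ) * M * N) ^ (11 / 12 + ε) = (c : ℝ) ^ (11 / 12 + ε) * ((M : ℝ) * N) ^ (11 / 12 + ε) := by
    rw [mul_assoc, Real.mul_rpow hc0.le (by positivity)]
  have h3 : (c : ℝ) ^ (1 / 12 : ℝ) * (c : ℝ) ^ (11 / 12 + ε) = (c : ℝ) ^ (1 + ε) := by
    rw [← Real.rpow_add hc0]; ring_nf
  calc C * ((c : ℝ) * M + N) ^ (1 / 12 : ℝ) * ((c : ℝ) * M * N) ^ (11 / 12 + ε)
      ≤ C * ((c : ℝ) ^ (1 / 12 : ℝ) * ((M : ℝ) + N) ^ (1 / 12 : ℝ)) *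
          ((c : ℝ) ^ (11 / 12 + ε) * ((M : ℝ) * N) ^ (11 / 12 + ε)) := by
        rw [h2]
        exact mul_le_mul_of_nonneg_right (mul_le_mul_of_nonneg_left h1 hC.le) (by positivity)
    _ = C * ((c : ℝ) ^ (1 / 12 : ℝ) * (c : ℝ) ^ (11 / 12 + ε)) * ((M : ℝ) + N) ^ (1 / 12 : ℝ) *
          ((M : ℝ) * N) ^ (11 / 12 + ε) := by ring
    _ = C * (c : ℝ) ^ (1 + ε) * ((M : ℝ) + N) ^ (1 / 12 : ℝ) * ((M : ℝ) * N) ^ (11 / 12 + ε) := by rw [h3]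

/-- **Type-II hypothesis of the engine, unconditionally**: `TypeIIBound (n ↦ λ(cn)) (C₂ c^{1+η})`.
[cite: FriedlanderIwaniecAnnals1998, §26] -/
theorem typeIIBound_quadEigenvalue_rpow :
    ∃ C₂ : ℝ, 0 ≤ C₂ ∧ ∀ d : ℕ, 1 ≤ d → ∀ χ : MulChar (GaussQuot (4 * d)) ℂ, ∀ k : ℤ,
      ∀ c : ℕ, 1 ≤ c → PrimeSumEngine.TypeIIBound (fun n => quadEigenvalue d χ k (c * n))
        (C₂ * (c : ℝ) ^ (1 + PrimeSumEngine.eta)) := by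
  obtain ⟨C, hC, h⟩ := norm_bilinear_quadEigenvalue_le (ε := PrimeSumEngine.eta)
    (by rw [PrimeSumEngine.eta]; norm_num)
  refine ⟨C, hC.le, fun d hd χ k c hc M N hM hN α β hα hβ => ?_⟩
  have hsum : ∑ m ∈ Ioc 0 M, ∑ n ∈ Ioc 0 N, α m * β n * quadEigenvalue d χ k (c * (m * n)) =
      ∑ m ∈ Icc 1 M, ∑ n ∈ Icc 1 N, α m * β n * quadEigenvalue d χ k (c * m * n) := by
    rw [Icc_one_eq_Ioc_zero, Icc_one_eq_Ioc_zero]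
    refine sum_congr rfl fun m _ => sum_congr rfl fun n _ => ?_
    simp only [mul_assoc]
  rw [hsum]
  exact (h d hd χ k c hc M N hM hN α β hα hβ).trans (le_of_eq (by ring))

/-! ### The trivial bound (used for `c > x²`) -/

/-- **Trivial bound**: `|Σ_{n ≤ X} Λ(n) λ(cn)| ≤ C c^{1/4} X^{3/2}` (from `|λ(cn)| ≤ τ(c)τ(n)`,
`Λ(n) ≤ log X`, `τ(n) ≪ n^{1/4}`). [cite: FriedlanderIwaniecAnnals1998, §23 (23.2)] -/
theorem norm_vonMangoldt_quadEigenvalue_le_trivial :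
    ∃ C : ℝ, 0 < C ∧ ∀ d : ℕ, 1 ≤ d → ∀ χ : MulChar (GaussQuot (4 * d)) ℂ, ∀ k : ℤ,
      ∀ c : ℕ, 1 ≤ c → ∀ X : ℕ, 1 ≤ X →
        ‖∑ n ∈ Ioc 0 X, ((Λ n : ℝ) : ℂ) * quadEigenvalue d χ k (c * n)‖ ≤
          C * (c : ℝ) ^ (1 / 4 : ℝ) * (X : ℝ) ^ (3 / 2 : ℝ) := by
  obtain ⟨Cτ, hCτ1, hCτ⟩ := Literature.NumberTheory.Sieve.exists_card_divisors_le_mul_rpow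
    (ε := 1 / 4) (by norm_num)
  refine ⟨4 * Cτ ^ 2, by positivity, fun d hd χ k c hc X hX => ?_⟩
  have hX0 : (0 : ℝ) < X := by exact_mod_cast hX
  have hc0 : (0 : ℝ) < c := by exact_mod_cast hc
  have hB := pointwiseBound_quadEigenvalue d hd χ k c
  have hτc : (c.divisors.card : ℝ) ≤ Cτ * (c : ℝ) ^ (1 / 4 : ℝ) := hCτ c (by omega)
  have hlogX : Real.log X ≤ 4 * (X : ℝ) ^ (1 / 4 : ℝ) := by
    have := Real.log_le_rpow_div hX0.le (by norm_num : (0 : ℝ) < 1 / 4)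
    linarith
  have hterm : ∀ n ∈ Ioc 0 X, ‖((Λ n : ℝ) : ℂ) * quadEigenvalue d χ k (c * n)‖ ≤
      Real.log X * (Cτ * (c : ℝ) ^ (1 / 4 : ℝ)) * (Cτ * (X : ℝ) ^ (1 / 4 : ℝ)) := by
    intro n hn
    rw [mem_Ioc] at hn
    have hn0 : (0 : ℝ) < n := by exact_mod_cast hn.1
    have hΛ : ‖((Λ n : ℝ) : ℂ)‖ ≤ Real.log X := by
      rw [Complex.norm_real, Real.norm_eq_abs, abs_of_nonneg ArithmeticFunction.vonMangoldt_nonneg]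
      exact ArithmeticFunction.vonMangoldt_le_log.trans (Real.log_le_log hn0 (by exact_mod_cast hn.2))
    have hlam : ‖quadEigenvalue d χ k (c * n)‖ ≤ (Cτ * (c : ℝ) ^ (1 / 4 : ℝ)) * (Cτ * (X : ℝ) ^ (1 / 4 : ℝ)) := by
      refine (hB n).trans ?_
      have hτn : (n.divisors.card : ℝ) ≤ Cτ * (X : ℝ) ^ (1 / 4 : ℝ) :=
        (hCτ n (by omega)).trans (mul_le_mul_of_nonneg_left
          (Real.rpow_le_rpow hn0.le (by exact_mod_cast hn.2) (by norm_num)) (by linarith))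
      exact mul_le_mul hτc hτn (by positivity) (by positivity)
    have hX1 : (1 : ℝ) ≤ X := by exact_mod_cast hX
    rw [norm_mul, mul_assoc]
    exact mul_le_mul hΛ hlam (norm_nonneg _) (Real.log_nonneg hX1)
  calc ‖∑ n ∈ Ioc 0 X, ((Λ n : ℝ) : ℂ) * quadEigenvalue d χ k (c * n)‖
      ≤ ∑ n ∈ Ioc 0 X, Real.log X * (Cτ * (c : ℝ) ^ (1 / 4 : ℝ)) * (Cτ * (X : ℝ) ^ (1 / 4 : ℝ)) :=
        (norm_sum_le _ _).trans (sum_le_sum hterm)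
    _ = X * (Real.log X * (Cτ * (c : ℝ) ^ (1 / 4 : ℝ)) * (Cτ * (X : ℝ) ^ (1 / 4 : ℝ))) := by
        rw [sum_const, Nat.card_Ioc, Nat.sub_zero, nsmul_eq_mul]
    _ ≤ X * (4 * (X : ℝ) ^ (1 / 4 : ℝ) * (Cτ * (c : ℝ) ^ (1 / 4 : ℝ)) * (Cτ * (X : ℝ) ^ (1 / 4 : ℝ))) := by
        refine mul_le_mul_of_nonneg_left ?_ hX0.le
        exact mul_le_mul_of_nonneg_right (mul_le_mul_of_nonneg_right hlogX (by positivity)) (by positivity)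
    _ = 4 * Cτ ^ 2 * (c : ℝ) ^ (1 / 4 : ℝ) * ((X : ℝ) ^ (1 : ℝ) * (X : ℝ) ^ (1 / 4 : ℝ) * (X : ℝ) ^ (1 / 4 : ℝ)) := by
        rw [Real.rpow_one]; ring
    _ = 4 * Cτ ^ 2 * (c : ℝ) ^ (1 / 4 : ℝ) * (X : ℝ) ^ (3 / 2 : ℝ) := by
        rw [← Real.rpow_add hX0, ← Real.rpow_add hX0]; norm_num

end FriedlanderIwaniecPrimes

/-- **Friedlander–Iwaniec, Theorem 2^ψ (26.2), power-saving form — unconditionally.** There is an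
absolute `C` with `|Σ_{n ≤ x} Λ(n) λ(cn)| ≤ C · c · d(|k|+1) · x^{1 - 1/1250}` for all `d, c ≥ 1`,
all characters `χ (mod 4d)`, all `k ∈ ℤ` and all `x ≥ 2`; hence
`FriedlanderIwaniec1998_theorem2psi_powerSaving`. Proof: for `c ≤ x²` the Vaughan engine
[tree: `PrimeSumEngine.exists_norm_sum_vonMangoldt_mul_le`] with Proposition 23.2 (type I,
`typeIBound_quadEigenvalue`), Proposition 21.4 ⇒ 23.1 (type II, `typeIIBound_quadEigenvalue_rpow`, constant
`c^{1+η}`, `c^η ≤ x^{2η}`) and `|λ(cn)| ≤ τ(c)τ(n)`; for `c > x²` the trivial bound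
`≪ c^{1/4} x^{3/2} ≤ c`. (The printed exponent is `76/77`.) This is the statement with the explicit
exponent `ϑ = 1 - 1/1250`; the existential form `FriedlanderIwaniec1998_theorem2psi_powerSaving_holds`
follows. [cite: FriedlanderIwaniecAnnals1998, Theorem 2^ψ (26.2)] -/
theorem FriedlanderIwaniec1998_theorem2psiWith_holds :
    FriedlanderIwaniec1998_theorem2psiWith (1 - 1 / 1250) := by
  obtain ⟨CE, hCE, hE⟩ := PrimeSumEngine.exists_norm_sum_vonMangoldt_mul_le
  obtain ⟨C₁, hC₁, hI⟩ := typeIBound_quadEigenvalue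
  obtain ⟨C₂, hC₂, hII⟩ := typeIIBound_quadEigenvalue_rpow
  obtain ⟨C₃, hC₃, hT⟩ := norm_vonMangoldt_quadEigenvalue_le_trivial
  refine ⟨CE * (C₁ + C₂ + 1) + C₃, ?_⟩
  intro d hd χ k c hc x hx
  set lam : ℕ → ℂ := fun n => quadEigenvalue d χ k (c * n) with hlam
  set f : ℝ := (d * (|k| + 1 : ℝ)) with hf
  have hf1 : (1 : ℝ) ≤ f := by
    have h1 : (1 : ℝ) ≤ d := by exact_mod_cast hd
    have h2 : (1 : ℝ) ≤ |(k : ℝ)| + 1 := by have := abs_nonneg (k : ℝ); linarith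
    rw [hf]; push_cast; nlinarith
  have hc1 : (1 : ℝ) ≤ c := by exact_mod_cast hc
  have hc0 : (0 : ℝ) < c := by linarith
  have hx0 : (0 : ℝ) < x := by linarith
  have hx1 : (1 : ℝ) ≤ x := by linarith
  have hτc : (c.divisors.card : ℝ) ≤ c := by exact_mod_cast Nat.card_divisors_le_self c
  set X : ℕ := ⌊x⌋₊ with hX
  have hX2 : 2 ≤ X := by rw [hX]; exact Nat.le_floor (by exact_mod_cast hx)
  have hXx : (X : ℝ) ≤ x := Nat.floor_le hx0.le
  have hX0 : (0 : ℝ) < X := by exact_mod_cast (by omega : 0 < X)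
  -- identify the sum
  have hsum : vonMangoldtEigenSum d χ k c x = ∑ n ∈ Ioc 0 X, ((Λ n : ℝ) : ℂ) * lam n := by
    rw [vonMangoldtEigenSum, FriedlanderIwaniecPrimes.Icc_one_eq_Ioc_zero]
  rw [hsum]
  have hxpow1 : (1 : ℝ) ≤ x ^ (1 - 1 / 1250 : ℝ) := Real.one_le_rpow hx1 (by norm_num)
  have hgoal0 : 0 ≤ (CE * (C₁ + C₂ + 1) + C₃) * c * (d * (|k| + 1 : ℝ)) * x ^ (1 - 1 / 1250 : ℝ) := by
    rw [← hf]; positivity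
  by_cases hcx : (c : ℝ) ≤ x ^ 2
  · -- `c ≤ x²`: the engine
    set W : ℝ := C₁ * c * f + C₂ * (c : ℝ) ^ (1 + PrimeSumEngine.eta) with hW
    have hW0 : 0 ≤ W := by positivity
    have hIW : PrimeSumEngine.TypeIBound lam W :=
      typeIBound_mono (hI d hd χ k c hc) (by rw [hW, hf]; linarith [(by positivity : 0 ≤ C₂ * (c : ℝ) ^ (1 + PrimeSumEngine.eta))])
    have hIIW : PrimeSumEngine.TypeIIBound lam W :=
      typeIIBound_mono (hII d hd χ k c hc) (by rw [hW]; linarith [(by positivity : 0 ≤ C₁ * (c : ℝ) * f)])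
    have hB := pointwiseBound_quadEigenvalue d hd χ k c
    have hengine := hE lam W c.divisors.card hW0 (by positivity) hIW hIIW hB X (by omega)
    refine hengine.trans ?_
    -- `c ≤ c^{1+η} ≤ c x^{2η}`
    have hη0 : 0 < PrimeSumEngine.eta := by rw [PrimeSumEngine.eta]; norm_num
    have hcpow : (c : ℝ) ^ (1 + PrimeSumEngine.eta) ≤ c * x ^ (2 * PrimeSumEngine.eta) := by
      rw [Real.rpow_add hc0, Real.rpow_one]
      refine mul_le_mul_of_nonneg_left ?_ hc0.le
      calc (c : ℝ) ^ PrimeSumEngine.eta ≤ (x ^ 2) ^ PrimeSumEngine.eta :=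
            Real.rpow_le_rpow hc0.le hcx hη0.le
        _ = x ^ (2 * PrimeSumEngine.eta) := by
            rw [show (x ^ 2 : ℝ) = x ^ (2 : ℝ) by norm_cast, ← Real.rpow_mul hx0.le]
    have hcc : (c : ℝ) ≤ (c : ℝ) ^ (1 + PrimeSumEngine.eta) := by
      calc (c : ℝ) = (c : ℝ) ^ (1 : ℝ) := (Real.rpow_one _).symm
        _ ≤ (c : ℝ) ^ (1 + PrimeSumEngine.eta) := Real.rpow_le_rpow_of_exponent_le hc1 (by linarith)
    have hWB : W + c.divisors.card ≤ (C₁ + C₂ + 1) * (c * x ^ (2 * PrimeSumEngine.eta)) * f := by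
      rw [hW]
      have hcx' : (c : ℝ) ≤ c * x ^ (2 * PrimeSumEngine.eta) := hcc.trans hcpow
      have h1 : C₁ * (c : ℝ) * f ≤ C₁ * (c * x ^ (2 * PrimeSumEngine.eta)) * f := by
        have : 0 ≤ C₁ := by linarith
        gcongr
      have h2 : C₂ * (c : ℝ) ^ (1 + PrimeSumEngine.eta) ≤ C₂ * (c * x ^ (2 * PrimeSumEngine.eta)) * f := by
        calc C₂ * (c : ℝ) ^ (1 + PrimeSumEngine.eta) ≤ C₂ * (c * x ^ (2 * PrimeSumEngine.eta)) :=
              mul_le_mul_of_nonneg_left hcpow hC₂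
          _ = C₂ * (c * x ^ (2 * PrimeSumEngine.eta)) * 1 := (mul_one _).symm
          _ ≤ C₂ * (c * x ^ (2 * PrimeSumEngine.eta)) * f := mul_le_mul_of_nonneg_left hf1 (by positivity)
      have h3 : (c.divisors.card : ℝ) ≤ 1 * (c * x ^ (2 * PrimeSumEngine.eta)) * f := by
        calc (c.divisors.card : ℝ) ≤ c := hτc
          _ ≤ c * x ^ (2 * PrimeSumEngine.eta) := hcx'
          _ = 1 * (c * x ^ (2 * PrimeSumEngine.eta)) * 1 := by ring
          _ ≤ 1 * (c * x ^ (2 * PrimeSumEngine.eta)) * f := mul_le_mul_of_nonneg_left hf1 (by positivity)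
      linarith
    have hXpow : (X : ℝ) ^ (1 - 1 / 1000 : ℝ) ≤ x ^ (1 - 1 / 1000 : ℝ) :=
      Real.rpow_le_rpow hX0.le hXx (by norm_num)
    have hexp : x ^ (2 * PrimeSumEngine.eta) * x ^ (1 - 1 / 1000 : ℝ) = x ^ (1 - 1 / 1250 : ℝ) := by
      rw [← Real.rpow_add hx0, PrimeSumEngine.eta]; norm_num
    calc CE * (W + c.divisors.card) * (X : ℝ) ^ (1 - 1 / 1000 : ℝ)
        ≤ CE * ((C₁ + C₂ + 1) * (c * x ^ (2 * PrimeSumEngine.eta)) * f) * x ^ (1 - 1 / 1000 : ℝ) :=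
          mul_le_mul (mul_le_mul_of_nonneg_left hWB hCE.le) hXpow (by positivity) (by positivity)
      _ = CE * (C₁ + C₂ + 1) * c * f * (x ^ (2 * PrimeSumEngine.eta) * x ^ (1 - 1 / 1000 : ℝ)) := by ring
      _ = CE * (C₁ + C₂ + 1) * c * (d * (|k| + 1 : ℝ)) * x ^ (1 - 1 / 1250 : ℝ) := by rw [hexp, hf]
      _ ≤ (CE * (C₁ + C₂ + 1) + C₃) * c * (d * (|k| + 1 : ℝ)) * x ^ (1 - 1 / 1250 : ℝ) := by
          rw [← hf]
          have : 0 ≤ C₃ * c * f * x ^ (1 - 1 / 1250 : ℝ) := by positivity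
          nlinarith
  · -- `c > x²`: the trivial bound
    push Not at hcx
    have htriv := hT d hd χ k c hc X (by omega)
    refine htriv.trans ?_
    have hX32 : (X : ℝ) ^ (3 / 2 : ℝ) ≤ (c : ℝ) ^ (3 / 4 : ℝ) := by
      calc (X : ℝ) ^ (3 / 2 : ℝ) ≤ x ^ (3 / 2 : ℝ) := Real.rpow_le_rpow hX0.le hXx (by norm_num)
        _ = (x ^ 2) ^ (3 / 4 : ℝ) := by
            rw [show (x ^ 2 : ℝ) = x ^ (2 : ℝ) by norm_cast, ← Real.rpow_mul hx0.le]; norm_num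
        _ ≤ (c : ℝ) ^ (3 / 4 : ℝ) := Real.rpow_le_rpow (by positivity) hcx.le (by norm_num)
    have hcc : (c : ℝ) ^ (1 / 4 : ℝ) * (c : ℝ) ^ (3 / 4 : ℝ) = c := by
      rw [← Real.rpow_add hc0]; norm_num
    calc C₃ * (c : ℝ) ^ (1 / 4 : ℝ) * (X : ℝ) ^ (3 / 2 : ℝ)
        ≤ C₃ * (c : ℝ) ^ (1 / 4 : ℝ) * (c : ℝ) ^ (3 / 4 : ℝ) :=
          mul_le_mul_of_nonneg_left hX32 (by positivity)
      _ = C₃ * c * 1 * 1 := by rw [mul_assoc, hcc]; ring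
      _ ≤ C₃ * c * (d * (|k| + 1 : ℝ)) * x ^ (1 - 1 / 1250 : ℝ) := by
          rw [← hf]
          exact mul_le_mul (mul_le_mul_of_nonneg_left hf1 (by positivity)) hxpow1 zero_le_one (by positivity)
      _ ≤ (CE * (C₁ + C₂ + 1) + C₃) * c * (d * (|k| + 1 : ℝ)) * x ^ (1 - 1 / 1250 : ℝ) := by
          rw [← hf]
          have : 0 ≤ CE * (C₁ + C₂ + 1) * c * f * x ^ (1 - 1 / 1250 : ℝ) := by positivity
          nlinarith

/-- **Friedlander–Iwaniec, Theorem 2^ψ, power-saving form — unconditionally** (`∃ ϑ < 1`, from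
`FriedlanderIwaniec1998_theorem2psiWith_holds` with `ϑ = 1 - 1/1250`).
[cite: FriedlanderIwaniecAnnals1998, Theorem 2^ψ (26.2)] -/
theorem FriedlanderIwaniec1998_theorem2psi_powerSaving_holds :
    FriedlanderIwaniec1998_theorem2psi_powerSaving :=
  ⟨1 - 1 / 1250, by norm_num, FriedlanderIwaniec1998_theorem2psiWith_holds⟩

end Literature.NumberTheory.Sieve
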